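import Literature.NumberTheory.EllipticCurves.ConstantKernelIsogenySelmerTrivialNumberField
import Literature.NumberTheory.EllipticCurves.KubertTateFiveVeluIsogeny
import Literature.NumberTheory.NumberFields.CyclotomicFieldFourPrimes
import HarnessLib

/-!
# `Sel^φ(E_{m,n}/ℚ(i)) = 0` for the Kubert–Tate `5`-torsion family over the Gaussian field in the
# tame régime (the `φ`-side of the `5`-descent over `ℚ(i)`, class-wide, no named fact)

PROOF-ONLY file (theorems only, no definition, no named fact, no `sorry`), topic
`NumberTheory/EllipticCurves`.  The tree's `KubertTateFiveSelmerTame` proves, over `ℚ`, that the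
`φ`-Selmer group of Vélu's `5`-isogeny `φ : E_{m,n} → E_{m,n}/⟨(0,0)⟩` on the Kubert–Tate family
`E_{m,n} = [n-m, -mn, -mn², 0, 0]` vanishes as soon as `5 ∤ Δ` and no bad prime is `≡ 1 (mod 5)`
(Mazur's étale-kernel descent + Minkowski).  Here the base field is `K = ℚ(i) = ℚ(ζ₄)` (any `K` with
`IsCyclotomicExtension {4} ℚ K`; `𝓞 K = ℤ[i]`, `h_K = 1`, no real place), and Minkowski is replaced by
the tree's cyclic Hilbert class field (`ConstantKernelIsogenySelmerTrivialNumberField`, itself on the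
PROVED reciprocity `finrank_dvd_classNumber_of_isUnramifiedIn`).  The tame condition is read through the
splitting law of `ℤ[i]` (`CyclotomicFieldFourPrimes`: a prime `𝔭 ∣ ℓ` of `ℤ[i]` has `N𝔭 = ℓ^{ord₄ ℓ}`
for odd `ℓ`, and `N𝔭 ∣ ℓ²` always): `gcd(5, N𝔭 - 1) = 1` iff `ℓ ≢ 1 (mod 5)` and, when
`ℓ ≡ 4 (mod 5)`, `ℓ` splits (`ℓ ≡ 1 (mod 4)`).

* §1 `residueCard_eq_pow_inertiaDeg'`, `inertiaDeg'_le_two`, `residueCard_eq_of_mod_four_eq_one` —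
  `N𝔭 = ℓ^f`, `1 ≤ f ≤ 2`, and `f = 1` for `ℓ ≡ 1 (mod 4)`, for a finite place `𝔭 ∋ ℓ` of `ℚ(i)`.
* §2 `etale_or_tame_gaussian` — every finite place of `ℚ(i)` is étale (`Δ(E_{m,n}) ∉ 𝔭`) or tame
  (`5 ∉ 𝔭`, `gcd(5, N𝔭 - 1) = 1`) when `5 ∤ Δ` and every prime `ℓ ∣ Δ` has `ℓ ≢ 1 (mod 5)` and
  (`ℓ ≡ 4 (mod 5) ⇒ ℓ ≡ 1 (mod 4)`).
* §3 **`selmerGroup_fiveIsogeny_eq_bot_gaussian`** — `Sel^φ(E_{m,n}/ℚ(i)) = 0` in that régime; hence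
  `E'_{m,n}(ℚ(i)) = φ(E_{m,n}(ℚ(i)))` (`exists_toGeomPoints_eq_gaussian`) and `Ш(E_{m,n}/ℚ(i))[φ] = 0`
  (`ker_shaMap_fiveIsogeny_eq_bot_gaussian`); the instance `(m, n) = (13, 14)` (`E_{13/14} =
  [1,-182,-2548,0,0]`, `Δ = -2⁵·7⁵·13⁵·2029`, bad primes `2, 7, 13, 2029 ≡ 2, 2, 3, 4 (mod 5)`,
  `2029 ≡ 1 (mod 4)`): `selmerGroup_fiveIsogeny_eq_bot_gaussian_13_14`.

Why (stmt-BirchSwinnertonDyer-22356, «T = FiniteShaComponentTransfer»): the `μ₅`-side of the same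
descent over `ℚ(i)` bounds `Sel^{φ̂}(E'_{m,n}/ℚ(i))` by the Gaussian primes of `mn`; with this file's
`Sel^φ = 0` the two give `rank E_{m,n}(ℚ(i)) + t₅(E_{m,n}/ℚ(i)) + 1 ≤ #{𝔭 ∣ mn}` and, since
`Sel₅(E/ℚ(i)) = Sel₅(E/ℚ) ⊕ Sel₅(E^{(-1)}/ℚ)`, the door at `5` on the quadratic twists `E_{m,n}^{(-1)}`
(curves WITHOUT rational `5`-torsion) — the next instrument for T's load-bearing slice (cell census,
evidence #39 on the item).  BSD and T are NOT proved by any of this.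

## References

* [Mazur1977] B. Mazur, *Modular curves and the Eisenstein ideal*, Publ. Math. IHÉS 47 (1977),
  Ch. III §3 Thm. (3.1), Ch. I §1(g).
* [Fisher2001FiveSevenDescent] T. Fisher, *Some examples of 5 and 7 descent for elliptic curves
  over ℚ*, JEMS 3 (2001), §§1–2.
* [IrelandRosen1982] K. Ireland, M. Rosen, *A Classical Introduction to Modern Number Theory*,
  Ch. 9 §7 Lemmas 3–5 (splitting in `ℤ[i]`).
* [SilvermanAEC2009] J. H. Silverman, *AEC*, 2nd ed., Thm. X.4.2.
* [NeukirchANT1999] J. Neukirch, *Algebraic Number Theory* (1999), Ch. I §8 (primes over `p`,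
  inertia degree, fundamental identity Prop. (8.2)).
-/

noncomputable section

open scoped Classical
open Polynomial WeierstrassCurve NumberField IsDedekindDomain Field Ideal
open Literature.NumberTheory.EllipticCurves Literature.NumberTheory.GaloisRepresentations
  Literature.NumberTheory.NumberFields

namespace Literature.NumberTheory.EllipticCurves

namespace KubertTateVelu

/-! ## §1 Residue cardinalities of the finite places of `ℚ(i)` -/

section Places

variable {K : Type*} [Field K] [NumberField K]

/-- Every finite place of a number field contains a rational prime (`𝔭 ∩ ℤ = pℤ`).
[cite: NeukirchANT1999, Ch. I §8, p. 45 (before Prop. (8.2))] -/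
theorem exists_nat_prime_mem_asIdeal (v : HeightOneSpectrum (𝓞 K)) :
    ∃ ℓ : ℕ, ℓ.Prime ∧ (ℓ : 𝓞 K) ∈ v.asIdeal := by
  haveI := v.isPrime
  have hN0 : absNorm v.asIdeal ≠ 0 := absNorm_eq_zero_iff.not.mpr v.ne_bot
  have hN1 : absNorm v.asIdeal ≠ 1 := absNorm_eq_one_iff.not.mpr v.isPrime.ne_top
  have hmem : ((absNorm v.asIdeal : ℕ) : 𝓞 K) ∈ v.asIdeal := absNorm_mem v.asIdeal
  have key : ∀ k : ℕ, 2 ≤ k → (k : 𝓞 K) ∈ v.asIdeal → ∃ ℓ : ℕ, ℓ.Prime ∧ (ℓ : 𝓞 K) ∈ v.asIdeal := by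
    intro k
    induction k using Nat.strong_induction_on with
    | _ k ih =>
      intro hk2 hk
      have hmin : k.minFac.Prime := Nat.minFac_prime (by omega)
      obtain ⟨j, hj⟩ := Nat.minFac_dvd k
      have hk' : ((k.minFac * j : ℕ) : 𝓞 K) ∈ v.asIdeal := by rw [← hj]; exact hk
      rw [Nat.cast_mul] at hk'
      rcases v.isPrime.mem_or_mem hk' with h | h
      · exact ⟨_, hmin, h⟩
      · have hj0 : j ≠ 0 := by rintro rfl; rw [mul_zero] at hj; omega
        have hj1 : j ≠ 1 := by
          rintro rfl
          rw [Nat.cast_one] at h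
          exact v.isPrime.ne_top ((Ideal.eq_top_iff_one _).mpr h)
        have hjlt : j < k := by
          rw [hj]
          exact lt_mul_of_one_lt_left (by omega) hmin.one_lt
        exact ih j hjlt (by omega) h
  exact key _ (by omega) hmem

/-- A finite place `v ∋ ℓ` lies over `(ℓ) ⊂ ℤ` (`𝔭 ∩ ℤ = ℓℤ`). [cite: NeukirchANT1999, Ch. I §8, p. 45 (before Prop. (8.2))] -/
theorem liesOver_span_of_natCast_mem (v : HeightOneSpectrum (𝓞 K)) {ℓ : ℕ} (hℓ : ℓ.Prime)
    (hℓv : (ℓ : 𝓞 K) ∈ v.asIdeal) : v.asIdeal.LiesOver (span {(ℓ : ℤ)}) := by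
  have hℓZ : (ℓ : ℤ) ≠ 0 := Int.natCast_ne_zero.mpr hℓ.ne_zero
  haveI : v.asIdeal.IsMaximal := v.isMaximal
  have hmax : (span {(ℓ : ℤ)}).IsMaximal :=
    ((span_singleton_prime hℓZ).mpr (Nat.prime_iff_prime_int.mp hℓ)).isMaximal (by simpa using hℓZ)
  refine ⟨hmax.eq_of_le (comap_ne_top _ v.isMaximal.ne_top) ?_⟩
  rw [span_le, Set.singleton_subset_iff]
  change algebraMap ℤ (𝓞 K) (ℓ : ℤ) ∈ v.asIdeal
  simpa using hℓv

/-- `N v = ℓ ^ f(v|ℓ)` for the rational prime `ℓ ∈ v` — the inertia degree `f = [𝓞/𝔭 : ℤ/ℓ]`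
(Mathlib `Ideal.absNorm_eq_pow_inertiaDeg'`). [cite: NeukirchANT1999, Ch. I §8, Def. before Prop. (8.2)] -/
theorem residueCard_eq_pow_inertiaDeg' (v : HeightOneSpectrum (𝓞 K)) {ℓ : ℕ} (hℓ : ℓ.Prime)
    (hℓv : (ℓ : 𝓞 K) ∈ v.asIdeal) :
    v.residueCard = ℓ ^ (span {(ℓ : ℤ)}).inertiaDeg' v.asIdeal := by
  haveI := liesOver_span_of_natCast_mem v hℓ hℓv
  rw [HeightOneSpectrum.residueCard, absNorm_eq_pow_inertiaDeg' v.asIdeal hℓ]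

/-- `1 ≤ f(v|ℓ) ≤ [K : ℚ]` (the fundamental identity `∑ eᵢfᵢ = [K : ℚ]`).
[cite: NeukirchANT1999, Ch. I §8 Prop. (8.2)] -/
theorem one_le_inertiaDeg'_le_finrank (v : HeightOneSpectrum (𝓞 K)) {ℓ : ℕ} (hℓ : ℓ.Prime)
    (hℓv : (ℓ : 𝓞 K) ∈ v.asIdeal) :
    1 ≤ (span {(ℓ : ℤ)}).inertiaDeg' v.asIdeal ∧
      (span {(ℓ : ℤ)}).inertiaDeg' v.asIdeal ≤ Module.finrank ℚ K := by
  have hℓZ : (ℓ : ℤ) ≠ 0 := Int.natCast_ne_zero.mpr hℓ.ne_zero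
  haveI := liesOver_span_of_natCast_mem v hℓ hℓv
  haveI := v.isPrime
  haveI hmax : (span {(ℓ : ℤ)}).IsMaximal :=
    ((span_singleton_prime hℓZ).mpr (Nat.prime_iff_prime_int.mp hℓ)).isMaximal (by simpa using hℓZ)
  refine ⟨?_, inertiaDeg_le_finrank (𝓞 K) ℚ K v.asIdeal (by simpa using hℓZ)⟩
  have h := v.one_lt_residueCard
  rw [residueCard_eq_pow_inertiaDeg' v hℓ hℓv] at h
  rcases Nat.eq_zero_or_pos ((span {(ℓ : ℤ)}).inertiaDeg' v.asIdeal) with h0 | h0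
  · rw [h0, pow_zero] at h
    exact absurd h (lt_irrefl _)
  · exact h0

variable [IsCyclotomicExtension {4} ℚ K]

/-- A rational prime other than `2` does not divide `4`. [folklore] -/
private theorem not_dvd_four_of_prime_ne_two {ℓ : ℕ} (hℓ : ℓ.Prime) (hℓ2 : ℓ ≠ 2) : ¬ ℓ ∣ 4 :=
  fun h ↦ hℓ2 ((Nat.prime_dvd_prime_iff_eq hℓ Nat.prime_two).mp
    (hℓ.dvd_of_dvd_pow (show ℓ ∣ 2 ^ 2 by simpa using h)))

/-- **Splitting in `ℤ[i]`**: a finite place `v ∋ ℓ` of `ℚ(ζ₄)`, `ℓ` odd, has `N v = ℓ ^ ord₄(ℓ)`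
(Mathlib's cyclotomic splitting law `IsCyclotomicExtension.Rat.inertiaDeg_eq_of_not_dvd`).
[cite: IrelandRosen1982, Ch. 9 §7 Lemmas 4–5] -/
theorem residueCard_eq_pow_orderOf_four (v : HeightOneSpectrum (𝓞 K)) {ℓ : ℕ} (hℓ : ℓ.Prime)
    (hℓ2 : ℓ ≠ 2) (hℓv : (ℓ : 𝓞 K) ∈ v.asIdeal) : v.residueCard = ℓ ^ orderOf (ℓ : ZMod 4) := by
  haveI := Fact.mk hℓ
  haveI := liesOver_span_of_natCast_mem v hℓ hℓv
  haveI : v.asIdeal.IsMaximal := v.isMaximal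
  rw [residueCard_eq_pow_inertiaDeg' v hℓ hℓv, inertiaDeg'_eq_inertiaDeg (span {(ℓ : ℤ)}) v.asIdeal,
    IsCyclotomicExtension.Rat.inertiaDeg_eq_of_not_dvd ℓ K v.asIdeal (m := 4)
      (not_dvd_four_of_prime_ne_two hℓ hℓ2)]

/-- **Split primes**: for `ℓ ≡ 1 (mod 4)` every finite place `v ∋ ℓ` of `ℚ(i)` has `N v = ℓ`.
[cite: IrelandRosen1982, Ch. 9 §7 Lemma 5] -/
theorem residueCard_eq_of_mod_four_eq_one (v : HeightOneSpectrum (𝓞 K)) {ℓ : ℕ} (hℓ : ℓ.Prime)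
    (hℓ1 : ℓ % 4 = 1) (hℓv : (ℓ : 𝓞 K) ∈ v.asIdeal) : v.residueCard = ℓ := by
  have hℓ2 : ℓ ≠ 2 := by rintro rfl; norm_num at hℓ1
  have hord : orderOf (ℓ : ZMod 4) = 1 := by
    have hℓ4 : (ℓ : ZMod 4) = 1 := by
      rw [← ZMod.natCast_mod ℓ 4, hℓ1]; rfl
    rw [hℓ4, orderOf_one]
  rw [residueCard_eq_pow_orderOf_four v hℓ hℓ2 hℓv, hord, pow_one]

/-- `[ℚ(ζ₄) : ℚ] = φ(4) = 2`. [folklore] -/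
private theorem finrank_rat_four : Module.finrank ℚ K = 2 := by
  rw [IsCyclotomicExtension.finrank (n := 4) K (Polynomial.cyclotomic.irreducible_rat (by norm_num)),
    show Nat.totient 4 = 2 by decide]

/-- For any finite place `v ∋ ℓ` of `ℚ(i)`: `N v = ℓ` or `N v = ℓ²`. [cite: IrelandRosen1982, Ch. 9 §7 Lemmas 3–5] -/
theorem residueCard_eq_or_eq_sq (v : HeightOneSpectrum (𝓞 K)) {ℓ : ℕ} (hℓ : ℓ.Prime)
    (hℓv : (ℓ : 𝓞 K) ∈ v.asIdeal) : v.residueCard = ℓ ∨ v.residueCard = ℓ ^ 2 := by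
  obtain ⟨h1, h2⟩ := one_le_inertiaDeg'_le_finrank v hℓ hℓv
  rw [finrank_rat_four] at h2
  rw [residueCard_eq_pow_inertiaDeg' v hℓ hℓv]
  interval_cases (span {(ℓ : ℤ)}).inertiaDeg' v.asIdeal
  · left; rw [pow_one]
  · right; rfl

end Places

/-! ## §2 The étale/tame hypothesis for `E_{m,n}` over `ℚ(i)` -/

section Gaussian

/-- Two affine points with equal coordinates are equal (proof-irrelevant form). [folklore] -/
private theorem some_eq_some_of_eq {R : Type*} [CommRing R] {V : WeierstrassCurve R}
    {x y x' y' : R} (hx : x = x') (hy : y = y') (h : V.toAffine.Nonsingular x y)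
    (h' : V.toAffine.Nonsingular x' y') : Affine.Point.some x y h = Affine.Point.some x' y' h' := by
  subst hx hy; rfl

variable {K : Type} [Field K] [NumberField K] [IsCyclotomicExtension {4} ℚ K]
variable (m n : ℤ) [hE : (kubertTateFive (m : K) (n : K)).IsElliptic]

omit [NumberField K] [IsCyclotomicExtension {4} ℚ K] hE in
/-- The integer model, base-changed to `K`. [cite: Kubert1976, Table 3 (N = 5)] -/
theorem eq_map_int_of_field :
    kubertTateFive (m : K) (n : K) = (kubertTateFive m n).map (Int.castRingHom K) := by
  rw [map_kubertTateFive]; rfl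

omit [IsCyclotomicExtension {4} ℚ K] in
/-- **The kernel points are integral** (over any number field): a non-zero `P ∈ ker φ` is `(a, b)` with
`(a, b) ∈ {(0,0), (0,mn²), (mn,m²n), (mn,0)} ⊂ ℤ²`. [cite: Velu1971, formulae] -/
theorem exists_int_of_mem_ker_of_field (P : geomPoints (kubertTateFive (m : K) (n : K)))
    (hP : P ∈ (fiveIsogeny (m : K) (n : K)).toAddMonoidHom.ker) (hP0 : P ≠ 0) :
    ∃ (a b : ℤ) (h : ((kubertTateFive (m : K) (n : K)).baseChange (AlgebraicClosure K)).toAffine.Nonsingular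
      (a : AlgebraicClosure K) (b : AlgebraicClosure K)), P = Affine.Point.some _ _ h := by
  have hP' : fiveIsogeny (m : K) (n : K) P = 0 := hP
  have cast : ∀ z : ℤ, algebraMap K (AlgebraicClosure K) (z : K) = ((z : ℤ) : AlgebraicClosure K) :=
    fun z ↦ by rw [map_intCast]
  have c0 : ((0 : ℤ) : AlgebraicClosure K) = 0 := Int.cast_zero
  have c1 : (((m * n ^ 2 : ℤ)) : AlgebraicClosure K) =
      algebraMap K (AlgebraicClosure K) ((m : K) * (n : K) ^ 2) := by
    rw [← cast]; push_cast; rfl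
  have c2 : (((m * n : ℤ)) : AlgebraicClosure K) = algebraMap K (AlgebraicClosure K) ((m : K) * (n : K)) := by
    rw [← cast]; push_cast; rfl
  have c3 : (((m ^ 2 * n : ℤ)) : AlgebraicClosure K) =
      algebraMap K (AlgebraicClosure K) ((m : K) ^ 2 * (n : K)) := by
    rw [← cast]; push_cast; rfl
  rcases mem_ker_fiveIsogeny_imp (m : K) (n : K) hP' with rfl | ⟨x, y, h, rfl, hxy⟩
  · exact absurd rfl hP0
  rcases hxy with ⟨hx, hy | hy⟩ | ⟨hx, hy | hy⟩ <;> subst hx <;> subst hy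
  · exact ⟨0, 0, by rw [c0]; exact h, some_eq_some_of_eq c0.symm c0.symm _ _⟩
  · exact ⟨0, m * n ^ 2, by rw [c0, c1]; exact h, some_eq_some_of_eq c0.symm c1.symm _ _⟩
  · exact ⟨m * n, 0, by rw [c0, c2]; exact h, some_eq_some_of_eq c2.symm c0.symm _ _⟩
  · exact ⟨m * n, m ^ 2 * n, by rw [c2, c3]; exact h, some_eq_some_of_eq c2.symm c3.symm _ _⟩

omit hE in
/-- **The étale/tame hypothesis over `ℚ(i)`, place by place.** If `5 ∤ Δ(E_{m,n})` and every prime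
`ℓ ∣ Δ(E_{m,n})` satisfies `ℓ ≢ 1 (mod 5)` and (`ℓ ≡ 4 (mod 5) ⇒ ℓ ≡ 1 (mod 4)`), then every finite
place `v` of `ℚ(i)` has `Δ(E_{m,n}) ∉ v`, or `5 ∉ v` and `gcd(5, N v - 1) = 1` (`N v = ℓ` for split
`ℓ ≡ 1 (4)`, `N v ∈ {ℓ, ℓ²}` always; `ℓ² ≡ 1 (mod 5)` iff `ℓ ≡ ±1`). [cite: Mazur1977, Ch. I §1(g)]
[cite: IrelandRosen1982, Ch. 9 §7 Lemmas 3–5] -/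
theorem etale_or_tame_gaussian (h5 : ¬ (5 : ℤ) ∣ (kubertTateFive m n).Δ)
    (hbad : ∀ ℓ : ℕ, ℓ.Prime → (ℓ : ℤ) ∣ (kubertTateFive m n).Δ → ℓ % 5 ≠ 1 ∧ (ℓ % 5 = 4 → ℓ % 4 = 1))
    (v : HeightOneSpectrum (𝓞 K)) :
    (((kubertTateFive m n).Δ : ℤ) : 𝓞 K) ∉ v.asIdeal ∨
      (((5 : ℕ) : 𝓞 K) ∉ v.asIdeal ∧ Nat.Coprime 5 (v.residueCard - 1)) := by
  obtain ⟨ℓ, hℓ, hℓv⟩ := exists_nat_prime_mem_asIdeal v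
  haveI := liesOver_span_of_natCast_mem v hℓ hℓv
  by_cases hdvd : (ℓ : ℤ) ∣ (kubertTateFive m n).Δ
  · right
    obtain ⟨hℓ5, hℓ4⟩ := hbad ℓ hℓ hdvd
    have hℓne5 : ℓ ≠ 5 := by
      rintro rfl; exact h5 (by exact_mod_cast hdvd)
    constructor
    · -- `5 ∉ v`: otherwise `1 = aℓ + 5b ∈ v`
      intro h5v
      have hcop : Nat.Coprime ℓ 5 := (Nat.coprime_primes hℓ Nat.prime_five).mpr hℓne5
      obtain ⟨a, b, hab⟩ := Nat.isCoprime_iff_coprime.mpr hcop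
      have hab' : a * (ℓ : ℤ) + b * 5 = 1 := by exact_mod_cast hab
      apply v.isPrime.ne_top
      rw [Ideal.eq_top_iff_one]
      have h1 : ((a * ℓ + b * 5 : ℤ) : 𝓞 K) = 1 := by rw [hab']; norm_num
      rw [← h1]
      push_cast
      exact v.asIdeal.add_mem (v.asIdeal.mul_mem_left _ hℓv)
        (v.asIdeal.mul_mem_left _ (by exact_mod_cast h5v))
    · -- `gcd(5, N v - 1) = 1`
      rw [Nat.Prime.coprime_iff_not_dvd Nat.prime_five]
      have hℓmod : ℓ % 5 = 2 ∨ ℓ % 5 = 3 ∨ ℓ % 5 = 4 := by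
        have h0 : ℓ % 5 ≠ 0 := fun h0 ↦ by
          have : 5 ∣ ℓ := Nat.dvd_of_mod_eq_zero h0
          exact hℓne5 ((Nat.prime_dvd_prime_iff_eq Nat.prime_five hℓ).mp this).symm
        omega
      rcases hℓmod with h2 | h3 | h4
      · rcases residueCard_eq_or_eq_sq v hℓ hℓv with hN | hN <;> rw [hN]
        · omega
        · have : ℓ ^ 2 % 5 = 4 := by rw [Nat.pow_mod, h2]
          omega
      · rcases residueCard_eq_or_eq_sq v hℓ hℓv with hN | hN <;> rw [hN]
        · omega
        · have : ℓ ^ 2 % 5 = 4 := by rw [Nat.pow_mod, h3]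
          omega
      · rw [residueCard_eq_of_mod_four_eq_one v hℓ (hℓ4 h4) hℓv]
        omega
  · left
    intro hΔ
    apply hdvd
    have h := (mem_of_liesOver v.asIdeal (span {(ℓ : ℤ)}) ((kubertTateFive m n).Δ)).mpr
      (by simpa using hΔ)
    exact mem_span_singleton.mp h

/-! ## §3 `Sel^φ(E_{m,n}/ℚ(i)) = 0` and its consequences -/

/-- **`Sel^φ(E_{m,n}/ℚ(i)) = 0` in the Gaussian tame régime** (`m, n ∈ ℤ`, `E_{m,n}` elliptic,
`5 ∤ Δ(E_{m,n})`, every prime `ℓ ∣ Δ` with `ℓ ≢ 1 (mod 5)` and `ℓ ≡ 4 (mod 5) ⇒ ℓ ≡ 1 (mod 4)`): the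
`ℤ/5`-side of the `5`-descent of `E_{m,n}` over `ℚ(i)` is empty — Mazur's étale-kernel descent over
`ℚ(i)` (`ConstantKernelDescent.selmerGroup_eq_bot_of_isCyclotomicExtension_four`: kernel constant and
integral, every place étale or tame, `h(ℚ(i)) = 1`). [cite: Mazur1977, Ch. III §3 Thm. (3.1) with Ch. I §1(g)]
[cite: Fisher2001FiveSevenDescent, §§1–2] -/
theorem selmerGroup_fiveIsogeny_eq_bot_gaussian (h5 : ¬ (5 : ℤ) ∣ (kubertTateFive m n).Δ)
    (hbad : ∀ ℓ : ℕ, ℓ.Prime → (ℓ : ℤ) ∣ (kubertTateFive m n).Δ → ℓ % 5 ≠ 1 ∧ (ℓ % 5 = 4 → ℓ % 4 = 1)) :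
    (fiveIsogeny (m : K) (n : K)).selmerGroup = ⊥ := by
  haveI : Fact (Nat.Prime 5) := ⟨Nat.prime_five⟩
  haveI : IsAddCyclic (fiveIsogeny (m : K) (n : K)).toAddMonoidHom.ker :=
    isAddCyclic_of_prime_card (p := 5) (natCard_ker_fiveIsogeny (m : K) (n : K))
  exact ConstantKernelDescent.selmerGroup_eq_bot_of_isCyclotomicExtension_four
    (fiveIsogeny (m : K) (n : K)) (kubertTateFive m n) (eq_map_int_of_field m n)
    (fun σ P hP ↦ smul_eq_of_mem_ker (m : K) (n : K) σ P hP) (exists_int_of_mem_ker_of_field m n)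
    (n := 5) (by norm_num) (fun P hP ↦ five_nsmul_eq_zero_of_mem_ker (m : K) (n : K) hP)
    (etale_or_tame_gaussian m n h5 hbad)

/-- **`E'_{m,n}(ℚ(i)) = φ(E_{m,n}(ℚ(i)))` in the Gaussian tame régime.** [cite: SilvermanAEC2009, Thm. X.4.2(a)] -/
theorem exists_toGeomPoints_eq_gaussian (h5 : ¬ (5 : ℤ) ∣ (kubertTateFive m n).Δ)
    (hbad : ∀ ℓ : ℕ, ℓ.Prime → (ℓ : ℤ) ∣ (kubertTateFive m n).Δ → ℓ % 5 ≠ 1 ∧ (ℓ % 5 = 4 → ℓ % 4 = 1))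
    (P' : (kubertTateFive' (m : K) (n : K)).toAffine.Point) :
    ∃ P : (kubertTateFive (m : K) (n : K)).toAffine.Point,
      (kubertTateFive' (m : K) (n : K)).toGeomPoints P' =
        fiveIsogeny (m : K) (n : K) ((kubertTateFive (m : K) (n : K)).toGeomPoints P) :=
  ConstantKernelDescent.exists_toGeomPoints_eq_of_selmerGroup_eq_bot (fiveIsogeny (m : K) (n : K))
    (selmerGroup_fiveIsogeny_eq_bot_gaussian m n h5 hbad) P'

/-- **`Ш(E_{m,n}/ℚ(i))[φ] = 0` in the Gaussian tame régime.** [cite: SilvermanAEC2009, Thm. X.4.2(a)] -/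
theorem ker_shaMap_fiveIsogeny_eq_bot_gaussian (h5 : ¬ (5 : ℤ) ∣ (kubertTateFive m n).Δ)
    (hbad : ∀ ℓ : ℕ, ℓ.Prime → (ℓ : ℤ) ∣ (kubertTateFive m n).Δ → ℓ % 5 ≠ 1 ∧ (ℓ % 5 = 4 → ℓ % 4 = 1)) :
    (shaMap (fiveIsogeny (m : K) (n : K)).toAddMonoidHom (fiveIsogeny (m : K) (n : K)).equivariant
      (fiveIsogeny (m : K) (n : K)).hasLocalPointsMaps_toAddMonoidHom).ker = ⊥ :=
  ConstantKernelDescent.ker_shaMap_eq_bot_of_selmerGroup_eq_bot (fiveIsogeny (m : K) (n : K))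
    (selmerGroup_fiveIsogeny_eq_bot_gaussian m n h5 hbad)

end Gaussian

/-! ## §4 The instance `(m, n) = (13, 14)` over `ℚ(i)` -/

section Instance1314

variable {K : Type} [Field K] [NumberField K] [IsCyclotomicExtension {4} ℚ K]

omit [IsCyclotomicExtension {4} ℚ K] in
/-- `E_{13/14} ⊗ ℚ(i) = [1, -182, -2548, 0, 0]` is elliptic: `Δ = -405171591170528 ≠ 0`.
[cite: Kubert1976, Table 3 (N = 5)] -/
theorem isElliptic_13_14_gaussian : (kubertTateFive ((13 : ℤ) : K) ((14 : ℤ) : K)).IsElliptic := by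
  refine ⟨isUnit_iff_ne_zero.mpr ?_⟩
  rw [eq_map_int_of_field (K := K) 13 14, map_Δ, kubertTateFive_Δ]
  norm_num

/-- **The instance `(m, n) = (13, 14)` over `ℚ(i)`** (`E_{13/14} = [1,-182,-2548,0,0]`, the tree's
rank-`2` door curve at `5`; `Δ = -2⁵·7⁵·13⁵·2029`, bad primes `2, 7, 13 ≡ 2, 2, 3 (mod 5)` and
`2029 ≡ 4 (mod 5)` with `2029 ≡ 1 (mod 4)` split in `ℤ[i]`): `Sel^φ(E_{13/14}/ℚ(i)) = 0`.
[cite: Mazur1977, Ch. III §3 Thm. (3.1)] [cite: Fisher2001FiveSevenDescent, §§1–2] -/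
theorem selmerGroup_fiveIsogeny_eq_bot_gaussian_13_14 :
    haveI := isElliptic_13_14_gaussian (K := K)
    (fiveIsogeny ((13 : ℤ) : K) ((14 : ℤ) : K)).selmerGroup = ⊥ := by
  haveI := isElliptic_13_14_gaussian (K := K)
  refine selmerGroup_fiveIsogeny_eq_bot_gaussian (K := K) 13 14 (by rw [kubertTateFive_Δ]; norm_num) ?_
  intro p hp hdvd
  rw [kubertTateFive_Δ] at hdvd
  norm_num at hdvd
  -- `Δ = -405171591170528 = -(2⁵·7⁵·13⁵·2029)`
  have h2029 : Nat.Prime 2029 := by norm_num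
  have hdvdN : p ∣ 2 ^ 5 * 7 ^ 5 * 13 ^ 5 * 2029 := by
    have h' : (p : ℤ) ∣ ((2 ^ 5 * 7 ^ 5 * 13 ^ 5 * 2029 : ℕ) : ℤ) := by
      have e : ((2 ^ 5 * 7 ^ 5 * 13 ^ 5 * 2029 : ℕ) : ℤ) = 405171591170528 := by norm_num
      rw [e]; exact hdvd
    exact Int.natCast_dvd_natCast.mp h'
  have hpi := Nat.Prime.prime hp
  rcases hpi.dvd_or_dvd hdvdN with h | h
  · rcases hpi.dvd_or_dvd h with h | h
    · rcases hpi.dvd_or_dvd h with h | h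
      · have := (Nat.prime_dvd_prime_iff_eq hp Nat.prime_two).mp (hpi.dvd_of_dvd_pow h); omega
      · have := (Nat.prime_dvd_prime_iff_eq hp (by norm_num)).mp (hpi.dvd_of_dvd_pow h); omega
    · have := (Nat.prime_dvd_prime_iff_eq hp (by norm_num)).mp (hpi.dvd_of_dvd_pow h); omega
  · have := (Nat.prime_dvd_prime_iff_eq hp h2029).mp h; omega

end Instance1314

end KubertTateVelu

end Literature.NumberTheory.EllipticCurves

end
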